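import Summits.HubbardSuperconductivity.HubbardSuperconductivity.Theorems.AnisotropyChordTransferFibre3EisensteinLambert

/-!
# Route `AnisotropyChord` / H0 rotor rung: the second Eisenstein–Lambert identity — `Σ n/(e^{πn} − 1) + 4Σ n/(e^{4πn} − 1) = 5/24 − 1/(2π)` (`E₂(i/2) + 4E₂(2i) = 12/π`)

Companion of p3 g2's `…Fibre3EisensteinLambert` (`Σ n/(e^{2πn} − 1) = 1/24 − 1/(8π)`, i.e. `E₂(i) = 3/π`).  The `S`-transformation
law of `G₂` (`Mathlib: EisensteinSeries.G2_S_transform`, `G₂(z) = z⁻²G₂(S•z) + 2πi/z`) at the NON-fixed point `z = 2i` (`S•2i = i/2`)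
gives `G₂(i/2) + 4G₂(2i) = 4π`, i.e. `E₂(i/2) + 4E₂(2i) = 12/π` (`E2_half_I_add`), although neither value is elementary; the
`q`-expansions at `q = e^{−π}` and `q = e^{−4π}` (`E2_eq_tsum_cexp` + the Lambert rearrangement `tsum_pow_div_one_sub_eq_tsum_sigma`)
turn it into ★ `lambert_pi_add_four_lambert_four_pi`: **`Σ_{n≥1} [n/(e^{πn} − 1) + 4n/(e^{4πn} − 1)] = 5/24 − 1/(2π)`**.
WHY (memo ROTOR-THEORY-21 §322, …Fibre3DiagonalRate): the SIGNED hyperbolic row corrections of the diagonal torus kernel are the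
parity-split Lambert sums at `q = e^{−π}`; with `Σ_{m even} m/(e^{πm}−1) = 2(1/24 − 1/(8π))` (p3) and this identity,
`Σ_{m odd} m/(e^{πm}+1) − Σ_{m even} m/(e^{πm}−1) = A(π) − 6A(2π) + 4A(4π) = 1/(4π) − 1/24` (`A(y) = Σ n/(e^{yn} − 1)`;
`signed_lambert_value`), which is exactly what makes the diagonal periodisation constant `−π/12 − 2π(1/(4π) − 1/24)·(−1) … = −1/2`:
the sharp law `V(a_L(n,n) − a_∞(n,n)) → −n²/2` (true `−|r|²/4`), the transcendental input of the sharp window periodisation bound (W2 of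
CAPACITY-DIAG-LEAN-g25.md §6).
Prover seat `hubbard-h0-rotor-p1` g25; helper for stmt-HubbardSuperconductivity-19089 (`--supports`).
WHAT THIS IS NOT: nothing here proves superconductivity in the Hubbard model (rotor TARGET as worded stays FALSE, g15); a classical
modular identity serving ONE constant of ONE input (periodisation) of ONE input (HOLE₂) of ONE conditional reduction (rung 19089).
Mathlib + tree imports only; no sorry, no axioms.
-/

set_option linter.dupNamespace false
set_option autoImplicit false

noncomputable section

open scoped BigOperators

namespace Summit.HubbardSuperconductivity.HubbardSuperconductivity.Theorems.AnisotropyChord.Transfer.Fibre3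

/-- `S • 2i = i/2` (for any `z, w ∈ ℍ` with these values). [folklore] -/
theorem S_smul_twoI (z w : UpperHalfPlane) (hz : (z : ℂ) = 2 * Complex.I) (hw : (w : ℂ) = Complex.I / 2) :
    ModularGroup.S • z = w := by
  apply UpperHalfPlane.ext
  rw [UpperHalfPlane.modular_S_smul, hw]
  show (-(z : ℂ))⁻¹ = Complex.I / 2
  rw [hz]
  have h2 : (-(2 * Complex.I)) * (Complex.I / 2) = 1 := by
    ring_nf; rw [Complex.I_sq]; ring
  exact inv_eq_of_mul_eq_one_right h2

/-- ★ `G₂(i/2) + 4·G₂(2i) = 4π` (the `S`-law at `z = 2i`). [folklore] -/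
theorem G2_halfI_add (z w : UpperHalfPlane) (hz : (z : ℂ) = 2 * Complex.I) (hw : (w : ℂ) = Complex.I / 2) :
    EisensteinSeries.G2 w + 4 * EisensteinSeries.G2 z = 4 * Real.pi := by
  have h := EisensteinSeries.G2_S_transform z
  rw [S_smul_twoI z w hz hw, hz] at h
  have e1 : ((2 * Complex.I) ^ 2)⁻¹ = -(1 / 4 : ℂ) := by
    rw [mul_pow, Complex.I_sq]; norm_num
  have e2 : -2 * (Real.pi : ℂ) * Complex.I / (2 * Complex.I) = -Real.pi := by
    have hI : Complex.I ≠ 0 := Complex.I_ne_zero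
    field_simp
  rw [e1, e2] at h
  linear_combination 4 * h

/-- ★ `E₂(i/2) + 4·E₂(2i) = 12/π`. [folklore] -/
theorem E2_halfI_add (z w : UpperHalfPlane) (hz : (z : ℂ) = 2 * Complex.I) (hw : (w : ℂ) = Complex.I / 2) :
    EisensteinSeries.E2 w + 4 * EisensteinSeries.E2 z = 12 / Real.pi := by
  have h1 : EisensteinSeries.E2 w = (1 / (2 * riemannZeta 2)) * EisensteinSeries.G2 w := by
    simp [EisensteinSeries.E2]
  have h2 : EisensteinSeries.E2 z = (1 / (2 * riemannZeta 2)) * EisensteinSeries.G2 z := by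
    simp [EisensteinSeries.E2]
  have h := G2_halfI_add z w hz hw
  have hpi : (Real.pi : ℂ) ≠ 0 := by exact_mod_cast Real.pi_ne_zero
  calc EisensteinSeries.E2 w + 4 * EisensteinSeries.E2 z
      = (1 / (2 * riemannZeta 2)) * (EisensteinSeries.G2 w + 4 * EisensteinSeries.G2 z) := by rw [h1, h2]; ring
    _ = (1 / (2 * riemannZeta 2)) * (4 * Real.pi) := by rw [h]
    _ = 12 / Real.pi := by
        rw [riemannZeta_two]
        field_simp
        ring

/-- the Lambert sum at `q = e^{−y}` over `ℂ` in terms of `E₂` at the corresponding point: if `exp(2πi·τ) = e^{−y}` then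
`Σ_{n≥1} n qⁿ/(1 − qⁿ) = (1 − E₂(τ))/24`. [folklore] -/
theorem lambert_sum_of_E2 (τ : UpperHalfPlane) (y : ℝ) (hy : 0 < y)
    (hq : Complex.exp (2 * (Real.pi : ℂ) * Complex.I * (τ : ℂ)) = ((Real.exp (-y) : ℝ) : ℂ)) :
    ∑' n : ℕ+, ((n : ℕ) : ℂ) * ((Real.exp (-y) : ℝ) : ℂ) ^ (n : ℕ) / (1 - ((Real.exp (-y) : ℝ) : ℂ) ^ (n : ℕ))
      = (1 - EisensteinSeries.E2 τ) / 24 := by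
  set r : ℂ := ((Real.exp (-y) : ℝ) : ℂ) with hr
  have hrn : ‖r‖ < 1 := by
    rw [hr, Complex.norm_real, Real.norm_eq_abs, abs_of_pos (Real.exp_pos _)]
    exact Real.exp_lt_one_iff.mpr (by linarith)
  have h1 := EisensteinSeries.E2_eq_tsum_cexp τ
  rw [hq] at h1
  have h2 := tsum_pow_div_one_sub_eq_tsum_sigma hrn 1
  simp only [pow_one] at h2
  rw [h2]
  linear_combination (1 / 24 : ℂ) * h1

/-- `exp(2πi·(i/2)) = e^{−π}`. [folklore] -/
theorem q_halfI (w : UpperHalfPlane) (hw : (w : ℂ) = Complex.I / 2) :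
    Complex.exp (2 * (Real.pi : ℂ) * Complex.I * (w : ℂ)) = ((Real.exp (-Real.pi) : ℝ) : ℂ) := by
  rw [hw, Complex.ofReal_exp]
  congr 1
  have : 2 * (Real.pi : ℂ) * Complex.I * (Complex.I / 2) = Real.pi * (Complex.I * Complex.I) := by ring
  rw [this, Complex.I_mul_I]; push_cast; ring

/-- `exp(2πi·(2i)) = e^{−4π}`. [folklore] -/
theorem q_twoI (z : UpperHalfPlane) (hz : (z : ℂ) = 2 * Complex.I) :
    Complex.exp (2 * (Real.pi : ℂ) * Complex.I * (z : ℂ)) = ((Real.exp (-(4 * Real.pi)) : ℝ) : ℂ) := by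
  rw [hz, Complex.ofReal_exp]
  congr 1
  have : 2 * (Real.pi : ℂ) * Complex.I * (2 * Complex.I) = 4 * Real.pi * (Complex.I * Complex.I) := by ring
  rw [this, Complex.I_mul_I]; push_cast; ring

/-- the complex form: `Σ n e^{−πn}/(1 − e^{−πn}) + 4Σ n e^{−4πn}/(1 − e^{−4πn}) = (5 − 12/π)/24`. [folklore] -/
theorem lambert_two_complex :
    (∑' n : ℕ+, ((n : ℕ) : ℂ) * ((Real.exp (-Real.pi) : ℝ) : ℂ) ^ (n : ℕ) / (1 - ((Real.exp (-Real.pi) : ℝ) : ℂ) ^ (n : ℕ)))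
      + 4 * (∑' n : ℕ+, ((n : ℕ) : ℂ) * ((Real.exp (-(4 * Real.pi)) : ℝ) : ℂ) ^ (n : ℕ)
          / (1 - ((Real.exp (-(4 * Real.pi)) : ℝ) : ℂ) ^ (n : ℕ)))
      = (5 - 12 / (Real.pi : ℂ)) / 24 := by
  obtain ⟨z, hz⟩ : ∃ z : UpperHalfPlane, (z : ℂ) = 2 * Complex.I :=
    ⟨UpperHalfPlane.mk (2 * Complex.I) (by simp), rfl⟩
  obtain ⟨w, hw⟩ : ∃ w : UpperHalfPlane, (w : ℂ) = Complex.I / 2 :=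
    ⟨UpperHalfPlane.mk (Complex.I / 2) (by simp), rfl⟩
  rw [lambert_sum_of_E2 w Real.pi Real.pi_pos (q_halfI w hw),
    lambert_sum_of_E2 z (4 * Real.pi) (by positivity) (q_twoI z hz)]
  have h := E2_halfI_add z w hz hw
  linear_combination (-1 / 24 : ℂ) * h

/-- the real Lambert function `n ↦ n ρⁿ/(1 − ρⁿ)` on `ℕ+` is summable with value computed through `ℂ`. [folklore] -/
theorem lambert_real_summable (y : ℝ) (hy : 0 < y) :
    Summable (fun n : ℕ+ => ((n : ℕ) : ℝ) * Real.exp (-y) ^ (n : ℕ) / (1 - Real.exp (-y) ^ (n : ℕ))) := by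
  set ρ : ℝ := Real.exp (-y) with hρ
  have hρpos : 0 < ρ := Real.exp_pos _
  have hρ1 : ρ < 1 := by rw [hρ]; exact Real.exp_lt_one_iff.mpr (by linarith)
  have hs : Summable (fun n : ℕ => (n : ℝ) ^ 1 * ρ ^ n) :=
    summable_pow_mul_geometric_of_norm_lt_one 1 (by rwa [Real.norm_eq_abs, abs_of_pos hρpos])
  have hs' : Summable (fun n : ℕ+ => ((n : ℕ) : ℝ) ^ 1 * ρ ^ (n : ℕ) / (1 - ρ)) :=
    (hs.div_const (1 - ρ)).comp_injective PNat.coe_injective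
  refine Summable.of_nonneg_of_le (fun n => ?_) (fun n => ?_) hs'
  · have : ρ ^ (n : ℕ) ≤ 1 := pow_le_one₀ hρpos.le hρ1.le
    apply div_nonneg (by positivity); linarith
  · have hn : ρ ^ (n : ℕ) ≤ ρ := by
      calc ρ ^ (n : ℕ) = ρ ^ ((n : ℕ) - 1) * ρ := by rw [← pow_succ, Nat.sub_add_cancel n.pos]
        _ ≤ 1 * ρ := mul_le_mul_of_nonneg_right (pow_le_one₀ hρpos.le hρ1.le) hρpos.le
        _ = ρ := one_mul ρ
    rw [pow_one]
    exact div_le_div_of_nonneg_left (by positivity) (by linarith) (by linarith)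

/-- the real Lambert sum at `e^{−y}` equals the complex one (cast). [folklore] -/
theorem lambert_real_cast (y : ℝ) :
    ((∑' n : ℕ+, ((n : ℕ) : ℝ) * Real.exp (-y) ^ (n : ℕ) / (1 - Real.exp (-y) ^ (n : ℕ)) : ℝ) : ℂ)
      = ∑' n : ℕ+, ((n : ℕ) : ℂ) * ((Real.exp (-y) : ℝ) : ℂ) ^ (n : ℕ) / (1 - ((Real.exp (-y) : ℝ) : ℂ) ^ (n : ℕ)) := by
  rw [Complex.ofReal_tsum]
  refine tsum_congr fun n => ?_
  push_cast
  ring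

/-- ★ **THE SECOND EISENSTEIN–LAMBERT IDENTITY** (real form over `ℕ+`):
`Σ_{n≥1} [n e^{−πn}/(1 − e^{−πn}) + 4·n e^{−4πn}/(1 − e^{−4πn})] = 5/24 − 1/(2π)`. [folklore] -/
theorem lambert_pi_add_four_lambert_four_pi :
    (∑' n : ℕ+, ((n : ℕ) : ℝ) * Real.exp (-Real.pi) ^ (n : ℕ) / (1 - Real.exp (-Real.pi) ^ (n : ℕ)))
      + 4 * (∑' n : ℕ+, ((n : ℕ) : ℝ) * Real.exp (-(4 * Real.pi)) ^ (n : ℕ) / (1 - Real.exp (-(4 * Real.pi)) ^ (n : ℕ)))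
      = 5 / 24 - 1 / (2 * Real.pi) := by
  apply Complex.ofReal_injective
  rw [Complex.ofReal_add, Complex.ofReal_mul, lambert_real_cast Real.pi, lambert_real_cast (4 * Real.pi),
    show ((4 : ℝ) : ℂ) = 4 by norm_num, lambert_two_complex]
  have hpi : (Real.pi : ℂ) ≠ 0 := by exact_mod_cast Real.pi_ne_zero
  push_cast
  field_simp
  ring

/-- ★ the diagonal periodisation constant: with `A_y = Σ_{n≥1} n e^{−yn}/(1−e^{−yn})` (`= Σ n/(e^{yn} − 1)`):
**`A_π − 6A_{2π} + 4A_{4π} = 1/(4π) − 1/24`** (p3's `E₂(i) = 3/π` value for `A_{2π}` and the identity above) — the value of the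
parity-signed Lambert sum `Σ_{m odd} m/(e^{πm}+1) − Σ_{m even} m/(e^{πm}−1)`. [folklore] -/
theorem signed_lambert_value :
    (∑' n : ℕ+, ((n : ℕ) : ℝ) * Real.exp (-Real.pi) ^ (n : ℕ) / (1 - Real.exp (-Real.pi) ^ (n : ℕ)))
      - 6 * (∑' n : ℕ+, ((n : ℕ) : ℝ) * Real.exp (-(2 * Real.pi)) ^ (n : ℕ) / (1 - Real.exp (-(2 * Real.pi)) ^ (n : ℕ)))
      + 4 * (∑' n : ℕ+, ((n : ℕ) : ℝ) * Real.exp (-(4 * Real.pi)) ^ (n : ℕ) / (1 - Real.exp (-(4 * Real.pi)) ^ (n : ℕ)))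
      = 1 / (4 * Real.pi) - 1 / 24 := by
  have h1 := lambert_pi_add_four_lambert_four_pi
  -- `A_{2π} = 1/24 − 1/(8π)` through `ℂ` (p3's `lambert_sum_complex`)
  have h2 : (∑' n : ℕ+, ((n : ℕ) : ℝ) * Real.exp (-(2 * Real.pi)) ^ (n : ℕ) / (1 - Real.exp (-(2 * Real.pi)) ^ (n : ℕ)))
      = 1 / 24 - 1 / (8 * Real.pi) := by
    apply Complex.ofReal_injective
    rw [lambert_real_cast (2 * Real.pi), lambert_sum_complex]
    have hpi : (Real.pi : ℂ) ≠ 0 := by exact_mod_cast Real.pi_ne_zero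
    push_cast
    field_simp
    ring
  rw [h2]
  have hπ := Real.pi_pos
  have h1' := h1
  field_simp at h1' ⊢
  linarith

end Summit.HubbardSuperconductivity.HubbardSuperconductivity.Theorems.AnisotropyChord.Transfer.Fibre3

end
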